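import Summits.CriticalPhenomena.PercolationContinuityZ3.Theorems.PercNearOneGluingAdditiveGluingKnLemma4Mult
import Summits.CriticalPhenomena.PercolationContinuityZ3.Theorems.PercNearOneGluingAdditiveGluingFullTieReduction
import Summits.CriticalPhenomena.PercolationContinuityZ3.Theorems.PercNearOneGluingAdditiveGluingEdgeAffine
import HarnessLib

/-!
# Crux `PercNearOneGluing.AdditiveGluing` (stmt-CriticalPhenomena-4576): the MULTIPLICATIVE raise step
# (raising the weight of a pair at its weaker endpoint never increases `μ(o↔b)/μ(a₁↔b)`, for every observer `o`)

Support file (`--supports stmt-CriticalPhenomena-4576`, lead png-lead-4576 / rtask e8780df7).  No definitions, no named facts,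
no sorries.

With `e = s(a₁, a₂)`, `w_s = w[e ↦ s]` (`Function.update w e (projIcc 0 1 s)`), `μ_s = prodBernoulli w_s`, `h_s(x) = μ_s(x ↔ b)`:
every `h_s(x)` is affine in `s` (`real_update_affine`), with slope `G_x = h₁(x) − h₀(x) = μ₀(Gain_x(e))` (the glued-pair gain event of
`knLemma4Mult`, via the gluing pushforward `fullTie_real_update_one`).  The multiplicative Lemma 4 at `w₀` gives
`G_o · h₀(a₁) ≤ G_{a₁} · h₀(o)` when `h₀(a₁) ≤ h₀(a₂)`, and the cross-difference `h_s(o)h_t(a₁) − h_s(a₁)h_t(o) = (s − t)(G_o h₀(a₁) − G_{a₁} h₀(o))`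
is therefore `≤ 0` for `t ≤ s`:

  **`knLemma4Mult_raise`**: if `h_t(a₁) ≤ h_t(a₂)` and `0 ≤ t ≤ s ≤ 1` then `h_s(o) · h_t(a₁) ≤ h_s(a₁) · h_t(o)` for EVERY `o`.

So along a raise of a pair at its weaker endpoint the ratio `h(o)/h(a₁)` is non-increasing: the multiplicative counterpart of the
additive raise step `tripleTie_raise` (KN Lemma 4), and the first rung of the multiplicative gluing flow for Conjecture 1
(potential `log h(o) − log min_A h − log μ(o↔A)`).  At `s = 1`: `μ_{G/e}(o↔b)/μ_G(o↔b) ≤ μ_{G/e}(a₁↔b)/μ_G(a₁↔b)`.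
[cite: KozmaNitzan2024, Lemma 4 / eq. (9) (pp. 9–10), §5.3 (p. 34); VandenbergHaggstromKahn2005, Thms. 1.3–1.4 (pp. 6–7)]
-/

namespace Summit.CriticalPhenomena.PercolationContinuityZ3.Theorems

open MeasureTheory Set Literature.Probability.LatticeModels Literature.Probability.Percolation

noncomputable section
open Classical

variable {n : ℕ}

/-- The glued-pair gain identity: `μ_{w[e↦1]}(x↔b) = μ_{w}(x↔b) + μ_{w}(Gain_x(e))` at the
weight-`0` point `w₀ = w[e ↦ 0]`: `μ_{w[e↦1]}(x↔b) − μ_{w[e↦0]}(x↔b) = μ_{w[e↦0]}({x↮b} ∩ ({x↔a₁}∩{a₂↔b} ∪ {x↔a₂}∩{a₁↔b}))`.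
[folklore] -/
theorem knLemma4Mult_slope_eq_gain (w : Sym2 (Fin n) → unitInterval) {a₁ a₂ : Fin n} (h12 : a₁ ≠ a₂) (x b : Fin n) :
    (prodBernoulli (Function.update w s(a₁, a₂) 1)).real (openConn x b) -
        (prodBernoulli (Function.update w s(a₁, a₂) 0)).real (openConn x b) =
      (prodBernoulli (Function.update w s(a₁, a₂) 0)).real
        ((openConn x b)ᶜ ∩ (openConn x a₁ ∩ openConn a₂ b ∪ openConn x a₂ ∩ openConn a₁ b)) := by
  have hm : ∀ s : Set (BondConfig (Fin n)), MeasurableSet s := fun _ => MeasurableSet.of_discrete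
  set w₀ := Function.update w s(a₁, a₂) 0 with hw₀
  have hupd : Function.update w s(a₁, a₂) 1 = Function.update w₀ s(a₁, a₂) 1 := by
    rw [hw₀, Function.update_idem]
  rw [hupd, fullTie_real_update_one w₀ h12 (openConn x b)]
  -- the preimage of `{x ↔ b}` under gluing is `{x↔b} ∪ Gain`
  have hpre : {ω : BondConfig (Fin n) | (ω ∪ {e | (∀ z ∈ e, z ∈ ({a₁, a₂} : Finset (Fin n))) ∧ ¬ e.IsDiag}) ∈
        (openConn x b : Set (BondConfig (Fin n)))} =
      (openConn x b) ∪ ((openConn x b)ᶜ ∩ (openConn x a₁ ∩ openConn a₂ b ∪ openConn x a₂ ∩ openConn a₁ b)) := by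
    ext ω
    simp only [Set.mem_setOf_eq, Set.mem_union, Set.mem_inter_iff, Set.mem_compl_iff]
    rw [fullTie_glueReach_pair]
    constructor
    · rintro (h | ⟨h1 | h2, hb1 | hb2⟩)
      · exact Or.inl h
      · exact Or.inl (SimpleGraph.Reachable.trans h1 hb1)
      · by_cases hxb : ω ∈ (openConn x b : Set (BondConfig (Fin n)))
        · exact Or.inl hxb
        · exact Or.inr ⟨hxb, Or.inl ⟨h1, hb2⟩⟩
      · by_cases hxb : ω ∈ (openConn x b : Set (BondConfig (Fin n)))
        · exact Or.inl hxb
        · exact Or.inr ⟨hxb, Or.inr ⟨h2, hb1⟩⟩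
      · exact Or.inl (SimpleGraph.Reachable.trans h2 hb2)
    · rintro (h | ⟨_, ⟨h1, hb2⟩ | ⟨h2, hb1⟩⟩)
      · exact Or.inl h
      · exact Or.inr ⟨Or.inl h1, Or.inr hb2⟩
      · exact Or.inr ⟨Or.inr h2, Or.inl hb1⟩
  rw [hpre, measureReal_union _ (hm _)]
  · ring
  · exact Set.disjoint_left.2 fun ω hω hω' => hω'.1 hω

/-- **The multiplicative raise step** (every observer).  With `e = s(a₁,a₂)`, `a₁ ≠ a₂`, `μ_s = prodBernoulli (w[e ↦ s])`:
if `μ_t(a₁↔b) ≤ μ_t(a₂↔b)` and `0 ≤ t ≤ s ≤ 1`, then `μ_s(o↔b) · μ_t(a₁↔b) ≤ μ_s(a₁↔b) · μ_t(o↔b)` — raising the pair at its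
weaker endpoint does not increase `μ(o↔b)/μ(a₁↔b)`.  From `knLemma4Mult` at `w[e ↦ 0]` and affinity in the weight of `e`.
[cite: KozmaNitzan2024, Lemma 4 / eq. (9) (pp. 9–10), §5.3 (p. 34)] -/
theorem knLemma4Mult_raise (w : Sym2 (Fin n) → unitInterval) (o b : Fin n) {a₁ a₂ : Fin n} (h12 : a₁ ≠ a₂)
    {s t : ℝ} (ht : 0 ≤ t) (hts : t ≤ s) (hs : s ≤ 1)
    (hle : (prodBernoulli (Function.update w s(a₁, a₂) (Set.projIcc (0:ℝ) 1 zero_le_one t))).real (openConn a₁ b) ≤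
      (prodBernoulli (Function.update w s(a₁, a₂) (Set.projIcc (0:ℝ) 1 zero_le_one t))).real (openConn a₂ b)) :
    (prodBernoulli (Function.update w s(a₁, a₂) (Set.projIcc (0:ℝ) 1 zero_le_one s))).real (openConn o b) *
        (prodBernoulli (Function.update w s(a₁, a₂) (Set.projIcc (0:ℝ) 1 zero_le_one t))).real (openConn a₁ b) ≤
      (prodBernoulli (Function.update w s(a₁, a₂) (Set.projIcc (0:ℝ) 1 zero_le_one s))).real (openConn a₁ b) *
        (prodBernoulli (Function.update w s(a₁, a₂) (Set.projIcc (0:ℝ) 1 zero_le_one t))).real (openConn o b) := by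
  -- trivial case `t = 1` (then `s = 1`)
  by_cases ht1 : t = 1
  · have hs1 : s = 1 := le_antisymm hs (ht1 ▸ hts)
    subst ht1; subst hs1
    exact le_of_eq (mul_comm _ _)
  have ht1' : t < 1 := lt_of_le_of_ne (hts.trans hs) ht1
  set e : Sym2 (Fin n) := s(a₁, a₂) with he
  set μ₀ := prodBernoulli (Function.update w e 0) with hμ₀
  set μ₁ := prodBernoulli (Function.update w e 1) with hμ₁
  have hsI : s ∈ Set.Icc (0:ℝ) 1 := ⟨ht.trans hts, hs⟩
  have htI : t ∈ Set.Icc (0:ℝ) 1 := ⟨ht, hts.trans hs⟩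
  -- affinity of the four probabilities
  have aff := fun (r : ℝ) (hr : r ∈ Set.Icc (0:ℝ) 1) (S : Set (BondConfig (Fin n))) => real_update_affine w e S hr
  rw [aff s hsI, aff s hsI, aff t htI, aff t htI]
  rw [aff t htI, aff t htI] at hle
  -- slopes = gains at `w₀`
  set Go := μ₁.real (openConn o b) - μ₀.real (openConn o b) with hGo
  set G1 := μ₁.real (openConn a₁ b) - μ₀.real (openConn a₁ b) with hG1
  set G2 := μ₁.real (openConn a₂ b) - μ₀.real (openConn a₂ b) with hG2
  have hGo_eq : Go = μ₀.real ((openConn o b)ᶜ ∩ (openConn o a₁ ∩ openConn a₂ b ∪ openConn o a₂ ∩ openConn a₁ b)) :=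
    knLemma4Mult_slope_eq_gain w h12 o b
  have hG1_eq : G1 = μ₀.real ((openConn a₁ b)ᶜ ∩ openConn a₂ b) := by
    have h := knLemma4Mult_slope_eq_gain w h12 a₁ b
    have hev : ((openConn a₁ b)ᶜ ∩ (openConn a₁ a₁ ∩ openConn a₂ b ∪ openConn a₁ a₂ ∩ openConn a₁ b) :
        Set (BondConfig (Fin n))) = (openConn a₁ b)ᶜ ∩ openConn a₂ b := by
      ext ω
      simp only [Set.mem_inter_iff, Set.mem_compl_iff, Set.mem_union]
      constructor
      · rintro ⟨hn, ⟨_, h2⟩ | ⟨_, h1⟩⟩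
        · exact ⟨hn, h2⟩
        · exact absurd h1 hn
      · rintro ⟨hn, h2⟩
        exact ⟨hn, Or.inl ⟨fullTie_mem_openConn_self a₁ ω, h2⟩⟩
    rw [hev] at h
    exact h
  -- the glued endpoint values coincide: `μ₁(a₁↔b) = μ₁(a₂↔b)`, so the order at `t < 1` transfers to `w₀`
  have hglue : μ₁.real (openConn a₁ b) = μ₁.real (openConn a₂ b) := by
    rw [hμ₁, he, fullTie_tau1_one w h12 b, fullTie_tau3_one w h12 b]
  have hG12 : G1 - G2 = μ₀.real (openConn a₂ b) - μ₀.real (openConn a₁ b) := by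
    simp only [hG1, hG2]; linarith [hglue]
  have h0 : μ₀.real (openConn a₁ b) ≤ μ₀.real (openConn a₂ b) := by
    nlinarith [hle, hG12, ht1']
  -- ML4 at `w₀`
  have key : Go * μ₀.real (openConn a₁ b) ≤ G1 * μ₀.real (openConn o b) := by
    have := knLemma4Mult (Function.update w e 0) o b a₁ a₂ h0
    rw [← hμ₀, ← hGo_eq, ← hG1_eq] at this
    linarith
  -- cross-difference `= (s - t)(Go h₀(a₁) - G1 h₀(o)) ≤ 0`
  have hst : 0 ≤ s - t := by linarith
  nlinarith [key, hst, mul_le_mul_of_nonneg_left key hst]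

end

end Summit.CriticalPhenomena.PercolationContinuityZ3.Theorems
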